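import Summits.Ventures.LatticeQCDFlow.Scoring.NonabelianAreaLaw2DTorusPeel
import Summits.Ventures.LatticeQCDFlow.Scoring.NonabelianAreaLaw2DOpenWilsonLoop
import Literature.MathematicalPhysics.QuantumFieldTheory.StrongCouplingActivities
import HarnessLib

/-!
# The exact non-abelian area law in two dimensions, V-b: torus expectations in `d = 2` as product-Haar ratios; the punctured-torus laws in real form

HONEST FRAMING: exact (Metropolis-corrected) sampling algorithms for lattice gauge theory;
figures of merit are autocorrelation/cost numbers at stated couplings and volumes; no
continuum-physics claim.

Venture `LatticeQCDFlow` (cell pub-lqcd), sub-topic `Scoring`; FANOUT row 5 (`s0-sun-a`), GEN-18.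
NEW WORK of the cell (placement rule).  On the full torus `(ℤ/L)²` with theory-2's Wilson measure
`μ_{L,β} ∝ e^{−β S(U)} Haar^{⊗E}`, `S = Σ_p (N − Re tr ρ(U_p))` (`Literature…ConstructiveQFTWave0.wilsonMeasure`),
every compact second-countable gauge group `G`, continuous representation `ρ`, any real `β`:

* §1 `exp_neg_mul_wilsonAction_two`, **`wilsonExpectation_two_eq_div`** — in `d = 2` the weight is the product
  of the one-plaquette weights `w(U_x) = e^{−β(N − Re tr ρ(U_x))}` over the sites, and
  `wilsonExpectation ρ β F = ∫ F ∏_x w(U_x) dHaar^{⊗E} / ∫ ∏_x w(U_x) dHaar^{⊗E}` for every `F`;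
* §2 `integral_prod_rect_mul_prod_punctured`, `integral_wilsonLoop_mul_prod_punctured` — real forms of
  part V-a: off a puncture, outer plaquettes weighted by `v` integrate to `∫ v` each, the region to
  `(∫w)^{RT}` resp. (scalar one-plaquette matrix `M_w = c·1`) the loop to `Re(c^{RT})`;
* part V-c (`TorusAreaLaw2DBound`) runs the one-bad-set expansion on these: `|⟨W_{R×T}⟩_{L,β}| ≤ P^{RT} + K q^{2RT}`
  uniformly in `L`; part V-d packages it as `HasAreaLaw 2 ρ β` for `U(N)`, `SU(N)`.
No `def`, nothing cited as a fact, 0 sorry.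
-/

noncomputable section

open MeasureTheory Function Finset
open Literature.MathematicalPhysics.QuantumFieldTheory
open Literature.MathematicalPhysics.QuantumLattice
open Summit.Ventures.LatticeQCDFlow.Theory2.Lattice
open Summit.Ventures.LatticeQCDFlow.Theory2.Lattice.TwoDim

namespace Summit.Ventures.LatticeQCDFlow.Scoring

variable {L : ℕ} [NeZero L] {G : Type*} [Group G] [TopologicalSpace G] [IsTopologicalGroup G]
  [CompactSpace G] [SecondCountableTopology G] [MeasurableSpace G] [BorelSpace G] {N : ℕ}
  (ρ : G →* Matrix (Fin N) (Fin N) ℂ)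

/-! ## §1. The torus Wilson weight in two dimensions; expectations as ratios -/

omit [TopologicalSpace G] [IsTopologicalGroup G] [CompactSpace G] [SecondCountableTopology G]
  [MeasurableSpace G] [BorelSpace G] in
/-- In two dimensions `e^{−β S(U)} = ∏_x e^{−β(N − Re tr ρ(U_x))}`, the product over the sites of the
one-plaquette weights of the `(0,1)`-holonomies. -/
theorem exp_neg_mul_wilsonAction_two (β : ℝ) (U : GaugeConfig 2 L G) :
    Real.exp (-β * wilsonAction ρ U) =
      ∏ x : Site 2 L, Real.exp (-(β * ((N : ℝ) - (ρ (plaquetteHolonomy U x 0 1)).trace.re))) := by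
  rw [wilsonAction_eq_sum_plaqAction,
    show -β * ∑ p, plaqAction ρ U p = ∑ p, -(β * plaqAction ρ U p) by
      rw [neg_mul, Finset.mul_sum, Finset.sum_neg_distrib],
    Real.exp_sum]
  let e : Plaquette 2 L ≃ Site 2 L :=
    { toFun := fun p => p.1
      invFun := fun x => (x, ⟨((0 : Fin 2), (1 : Fin 2)), by decide⟩)
      left_inv := fun p => Prod.ext rfl (plane_eq_zero_one p.2).symm
      right_inv := fun _ => rfl }
  refine Fintype.prod_equiv e _ _ fun p => ?_
  obtain ⟨x, q⟩ := p
  rw [plane_eq_zero_one q]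
  rfl

/-- **Torus expectations as ratios of product-Haar integrals** (`d = 2`, continuous `ρ`, any `F`):
`wilsonExpectation ρ β F = ∫ F(U) ∏_x w(U_x) dHaar^{⊗E} / ∫ ∏_x w(U_x) dHaar^{⊗E}`,
`w(g) = e^{−β(N − Re tr ρ(g))}`. -/
theorem wilsonExpectation_two_eq_div (hρ : Continuous ρ) (β : ℝ) (F : GaugeConfig 2 L G → ℝ) :
    wilsonExpectation ρ β F =
      (∫ U, F U * ∏ x : Site 2 L, Real.exp (-(β * ((N : ℝ) - (ρ (plaquetteHolonomy U x 0 1)).trace.re)))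
          ∂(Measure.pi fun _ : Edge 2 L => haarProbability G)) /
        ∫ U, ∏ x : Site 2 L, Real.exp (-(β * ((N : ℝ) - (ρ (plaquetteHolonomy U x 0 1)).trace.re)))
          ∂(Measure.pi fun _ : Edge 2 L => haarProbability G) := by
  have hdens : Measurable fun U : GaugeConfig 2 L G => ENNReal.ofReal (Real.exp (-β * wilsonAction ρ U)) :=
    (Real.measurable_exp.comp ((measurable_wilsonAction ρ hρ).const_mul _)).ennreal_ofReal
  have hcontS : Continuous fun U : GaugeConfig 2 L G => Real.exp (-β * wilsonAction ρ U) :=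
    Real.continuous_exp.comp (continuous_const.mul
      (Literature.MathematicalPhysics.QuantumFieldTheory.continuous_wilsonAction ρ hρ))
  have hZ : (partitionFunction (d := 2) (L := L) ρ β).toReal =
      ∫ U, ∏ x : Site 2 L, Real.exp (-(β * ((N : ℝ) - (ρ (plaquetteHolonomy U x 0 1)).trace.re)))
        ∂(Measure.pi fun _ : Edge 2 L => haarProbability G) := by
    rw [show partitionFunction (d := 2) (L := L) ρ β =
        ∫⁻ U, ENNReal.ofReal (Real.exp (-β * wilsonAction ρ U))
          ∂(Measure.pi fun _ : Edge 2 L => haarProbability G) by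
      simp only [partitionFunction, wilsonWeight, withDensity_apply _ MeasurableSet.univ, Measure.restrict_univ],
      ← integral_eq_lintegral_of_nonneg_ae (ae_of_all _ fun U => (Real.exp_pos _).le)
        hcontS.aestronglyMeasurable]
    simp_rw [exp_neg_mul_wilsonAction_two]
  unfold wilsonExpectation wilsonMeasure
  rw [integral_smul_measure, wilsonWeight,
    integral_withDensity_eq_integral_toReal_smul hdens (ae_of_all _ fun _ => ENNReal.ofReal_lt_top),
    ENNReal.toReal_inv, hZ, smul_eq_mul, div_eq_inv_mul]
  congr 1
  refine integral_congr_ae (ae_of_all _ fun U => ?_)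
  show (ENNReal.ofReal (Real.exp (-β * wilsonAction ρ U))).toReal • F U = _
  rw [ENNReal.toReal_ofReal (Real.exp_pos _).le, exp_neg_mul_wilsonAction_two, smul_eq_mul, mul_comm]

/-! ## §2. Real forms of the punctured-torus peeling -/

section Punctured

variable {w v : G → ℝ} (hw : Continuous w) (hwc : ∀ k g, w (k * g * k⁻¹) = w g) (hv : Continuous v)
include hw hwc hv

omit ρ in
/-- Off a puncture `x₀`: the region's weights integrate to `(∫w)^{RT}`, the outer ones to `∫ v` each (real form). -/
theorem integral_prod_rect_mul_prod_punctured (hL : 2 ≤ L) (i' j' : ZMod L) {R T : ℕ} (hR : R + 1 ≤ L)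
    (hT : T + 1 ≤ L) (x₀ : Site 2 L)
    (hx₀ : x₀ ∉ (range R ×ˢ range T).image (fun q : ℕ × ℕ => (![i' + q.1, j' + q.2] : Site 2 L)))
    (t : Finset (Site 2 L))
    (ht : ∀ x ∈ t, x ∉ (range R ×ˢ range T).image (fun q : ℕ × ℕ => (![i' + q.1, j' + q.2] : Site 2 L)))
    (hx₀t : x₀ ∉ t) :
    ∫ U, (∏ p ∈ (range R ×ˢ range T).image (fun q : ℕ × ℕ => (![i' + q.1, j' + q.2] : Site 2 L)),
        w (plaquetteHolonomy U p 0 1)) * ∏ x ∈ t, v (plaquetteHolonomy U x 0 1)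
        ∂(Measure.pi fun _ : Edge 2 L => haarProbability G) =
      (∫ g, v g ∂(haarProbability G)) ^ t.card * (∫ g, w g ∂(haarProbability G)) ^ (R * T) := by
  have hΦ : Continuous fun U : GaugeConfig 2 L G =>
      ∏ p ∈ (range R ×ˢ range T).image (fun q : ℕ × ℕ => (![i' + q.1, j' + q.2] : Site 2 L)),
        (w (plaquetteHolonomy U p 0 1) : ℂ) :=
    continuous_finsetProd _ fun p _ =>
      Complex.continuous_ofReal.comp (hw.comp (continuous_config_plaquetteHolonomy p 0 1))
  have h := integral_mul_prod_punctured_eq hL i' j' hR hT x₀ hx₀ hv hΦ (fun e U g he =>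
    Finset.prod_congr rfl fun p hp => by
      obtain ⟨h1, h2, h3, h4⟩ := he p hp
      rw [plaquetteHolonomy_update_of_ne g h1 h2 h3 h4]) t ht hx₀t
  apply Complex.ofReal_injective
  calc (((∫ U, (∏ p ∈ (range R ×ˢ range T).image (fun q : ℕ × ℕ => (![i' + q.1, j' + q.2] : Site 2 L)),
          w (plaquetteHolonomy U p 0 1)) * ∏ x ∈ t, v (plaquetteHolonomy U x 0 1)
          ∂(Measure.pi fun _ : Edge 2 L => haarProbability G) : ℝ)) : ℂ)
      = ∫ U, (∏ p ∈ (range R ×ˢ range T).image (fun q : ℕ × ℕ => (![i' + q.1, j' + q.2] : Site 2 L)),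
          (w (plaquetteHolonomy U p 0 1) : ℂ)) * ∏ x ∈ t, (v (plaquetteHolonomy U x 0 1) : ℂ)
          ∂(Measure.pi fun _ : Edge 2 L => haarProbability G) := by
        rw [← integral_complex_ofReal]
        congr 1
        funext U
        push_cast
        rfl
    _ = (∫ g, (v g : ℂ) ∂(haarProbability G)) ^ t.card *
          ∫ U, ∏ p ∈ (range R ×ˢ range T).image (fun q : ℕ × ℕ => (![i' + q.1, j' + q.2] : Site 2 L)),
            (w (plaquetteHolonomy U p 0 1) : ℂ) ∂(Measure.pi fun _ : Edge 2 L => haarProbability G) := h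
    _ = _ := by
        rw [integral_complex_ofReal,
          show (∫ U, ∏ p ∈ (range R ×ˢ range T).image (fun q : ℕ × ℕ => (![i' + q.1, j' + q.2] : Site 2 L)),
              (w (plaquetteHolonomy U p 0 1) : ℂ) ∂(Measure.pi fun _ : Edge 2 L => haarProbability G)) =
            (((∫ g, w g ∂(haarProbability G)) ^ (R * T) : ℝ) : ℂ) by
            rw [← integral_prod_weight_rect hw hwc i' j' hR hT, ← integral_complex_ofReal]
            congr 1
            funext U
            push_cast
            rfl]
        push_cast
        ring

/-- Off a puncture, with a scalar one-plaquette matrix `M_w = c·1`: the torus Wilson loop along the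
region's boundary integrates to `(∫v)^{#t} · Re(c^{RT})` (real form). -/
theorem integral_wilsonLoop_mul_prod_punctured [NeZero N] (hρ : Continuous ρ) (hL : 2 ≤ L) {c : ℂ}
    (hM : (Matrix.of fun k l : Fin N => ∫ g, ρ g k l * (w g : ℂ) ∂(haarProbability G)) =
      c • (1 : Matrix (Fin N) (Fin N) ℂ))
    (i' j' : ZMod L) {R T : ℕ} (hR1 : 1 ≤ R) (hT1 : 1 ≤ T) (hR : R + 1 ≤ L) (hT : T + 1 ≤ L) (x₀ : Site 2 L)
    (hx₀ : x₀ ∉ (range R ×ˢ range T).image (fun q : ℕ × ℕ => (![i' + q.1, j' + q.2] : Site 2 L)))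
    (t : Finset (Site 2 L))
    (ht : ∀ x ∈ t, x ∉ (range R ×ˢ range T).image (fun q : ℕ × ℕ => (![i' + q.1, j' + q.2] : Site 2 L)))
    (hx₀t : x₀ ∉ t) :
    ∫ U, wilsonLoop ρ (![i', j'] : Site 2 L) 0 1 R T U *
        ((∏ p ∈ (range R ×ˢ range T).image (fun q : ℕ × ℕ => (![i' + q.1, j' + q.2] : Site 2 L)),
          w (plaquetteHolonomy U p 0 1)) * ∏ x ∈ t, v (plaquetteHolonomy U x 0 1))
        ∂(Measure.pi fun _ : Edge 2 L => haarProbability G) =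
      (∫ g, v g ∂(haarProbability G)) ^ t.card * (c ^ (R * T)).re := by
  -- abbreviation for the complex weight factor
  have hF : ∀ U : GaugeConfig 2 L G,
      wilsonLoop ρ (![i', j'] : Site 2 L) 0 1 R T U *
        ((∏ p ∈ (range R ×ˢ range T).image (fun q : ℕ × ℕ => (![i' + q.1, j' + q.2] : Site 2 L)),
          w (plaquetteHolonomy U p 0 1)) * ∏ x ∈ t, v (plaquetteHolonomy U x 0 1)) =
        (N : ℝ)⁻¹ * (∑ a, ρ (rectangleHolonomy U ![i', j'] 0 1 R T) a a *
          ((∏ p ∈ (range R ×ˢ range T).image (fun q : ℕ × ℕ => (![i' + q.1, j' + q.2] : Site 2 L)),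
            (w (plaquetteHolonomy U p 0 1) : ℂ)) * ∏ x ∈ t, (v (plaquetteHolonomy U x 0 1) : ℂ))).re := by
    intro U
    rw [wilsonLoop, mul_assoc]
    congr 1
    rw [← Finset.sum_mul, ← Complex.ofReal_prod, ← Complex.ofReal_prod, ← Complex.ofReal_mul, Complex.mul_re,
      Complex.ofReal_re, Complex.ofReal_im, mul_zero, sub_zero]
    rfl
  have hint : ∀ a : Fin N, Integrable (fun U : GaugeConfig 2 L G =>
      ρ (rectangleHolonomy U ![i', j'] 0 1 R T) a a *
        ((∏ p ∈ (range R ×ˢ range T).image (fun q : ℕ × ℕ => (![i' + q.1, j' + q.2] : Site 2 L)),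
          (w (plaquetteHolonomy U p 0 1) : ℂ)) * ∏ x ∈ t, (v (plaquetteHolonomy U x 0 1) : ℂ)))
      (Measure.pi fun _ : Edge 2 L => haarProbability G) := fun a =>
    integrable_gaugeConfig_of_continuous
      (((hρ.comp (continuous_config_rectangleHolonomy _ 0 1 R T)).matrix_elem a a).mul
        ((continuous_finsetProd _ fun p _ =>
          Complex.continuous_ofReal.comp (hw.comp (continuous_config_plaquetteHolonomy p 0 1))).mul
          (continuous_finsetProd _ fun p _ =>
            Complex.continuous_ofReal.comp (hv.comp (continuous_config_plaquetteHolonomy p 0 1)))))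
  have hterm : ∀ a : Fin N, ∫ U, ρ (rectangleHolonomy U ![i', j'] 0 1 R T) a a *
        ((∏ p ∈ (range R ×ˢ range T).image (fun q : ℕ × ℕ => (![i' + q.1, j' + q.2] : Site 2 L)),
          (w (plaquetteHolonomy U p 0 1) : ℂ)) * ∏ x ∈ t, (v (plaquetteHolonomy U x 0 1) : ℂ))
        ∂(Measure.pi fun _ : Edge 2 L => haarProbability G) =
      (∫ g, (v g : ℂ) ∂(haarProbability G)) ^ t.card * c ^ (R * T) := by
    intro a
    simp_rw [← mul_assoc]
    rw [integral_rep_loop_mul_prod_punctured hL ρ hρ hw hwc hv i' j' hR1 hT1 hR hT x₀ hx₀ t ht hx₀t a a,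
      hM, smul_pow, one_pow, Matrix.smul_apply, Matrix.one_apply_eq, smul_eq_mul, mul_one]
  have hre : ∫ U, (∑ a, ρ (rectangleHolonomy U ![i', j'] 0 1 R T) a a *
        ((∏ p ∈ (range R ×ˢ range T).image (fun q : ℕ × ℕ => (![i' + q.1, j' + q.2] : Site 2 L)),
          (w (plaquetteHolonomy U p 0 1) : ℂ)) * ∏ x ∈ t, (v (plaquetteHolonomy U x 0 1) : ℂ))).re
        ∂(Measure.pi fun _ : Edge 2 L => haarProbability G) =
      (∫ U, ∑ a, ρ (rectangleHolonomy U ![i', j'] 0 1 R T) a a *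
        ((∏ p ∈ (range R ×ˢ range T).image (fun q : ℕ × ℕ => (![i' + q.1, j' + q.2] : Site 2 L)),
          (w (plaquetteHolonomy U p 0 1) : ℂ)) * ∏ x ∈ t, (v (plaquetteHolonomy U x 0 1) : ℂ))
        ∂(Measure.pi fun _ : Edge 2 L => haarProbability G)).re := by
    simpa only [RCLike.re_to_complex] using integral_re (integrable_finsetSum _ fun a _ => hint a)
  simp_rw [hF]
  rw [integral_const_mul, hre, integral_finsetSum _ fun a _ => hint a]
  simp only [hterm, Finset.sum_const, Finset.card_univ, Fintype.card_fin, nsmul_eq_mul]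
  rw [← Complex.ofReal_natCast, Complex.re_ofReal_mul, ← mul_assoc,
    inv_mul_cancel₀ (Nat.cast_ne_zero.mpr (NeZero.ne N)), one_mul, integral_complex_ofReal,
    ← Complex.ofReal_pow, Complex.re_ofReal_mul]

end Punctured

end Summit.Ventures.LatticeQCDFlow.Scoring
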